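import Summits.Ventures.CertifiedArithmetic.LowPrec.ExactCriteria

/-!
# THEOREMS-R1 in Lean: Lemma C (the carry bound) — and why Lemma C′ subsumes it for every format triple

HONEST FRAMING (venture CertifiedArithmetic / cell `pub-lowprec`): certified error envelopes and
provably optimal rounding/accumulation schemes for low-precision formats under stated cost models;
every table by two implementations; no hardware or vendor claims.

The one item of the cell's THEOREMS-R1.md still marked "NOT YET IN LEAN" (LEAN MAP, gen8,
2026-08-20) was Lemma C, the carry branch of the exact-sum criterion Theorem S:

> **Lemma C (carry bounds the low bit).** If `|x + y| ≥ 2^(E+1)` then both `|x|` and `|y|` are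
> multiples of `2^(E+2-P_X-P_Y)`; hence the sum spans at most `P_X + P_Y` bits.

Here `E` is the larger top exponent of the two operand formats, so `2^(E+1)` is the power of two
just above every operand magnitude. In common quanta `2^L`, `L = min(qexp₁, qexp₂)`, with the lifts
`a = (qexp₁ - qexp₂)⁺`, `b = (qexp₂ - qexp₁)⁺`, the operand magnitudes are `u = |x| · 2^a`,
`v = |y| · 2^b < 2^T` with `T = E - L + 1`, and the lemma says: `u + v ≥ 2^T` forces
`2^D ∣ u` and `2^D ∣ v` for `D = T + 1 - P₁ - P₂`. This file proves it (def-free):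

* `mul_pow_add_pow_le_pow` — the arithmetic heart, used three times: a `Q`-bit significand
  times a power of two lying below `2^P` (`Q ≤ P`) lies at least `2^(P-Q)` below it.
* `pow_dvd_of_carry` — Lemma C, integer core, for ANY strict bit bound `T` of the two magnitudes
  and any `D` with `D + P₁ + P₂ ≤ T + 1`; `exists_eq_mul_pow_of_carry` — the span form (the sum is
  `N' · 2^D` with `N' < 2^(T+1-D)`, i.e. at most `P₁ + P₂` bits when `D = T + 1 - P₁ - P₂`).
* `pow_dvd_scaledMag_of_carry` — Lemma C for data `x : MiniFloat φ₁`, `y : MiniFloat φ₂` (aligned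
  magnitudes `scaledMag · 2^a`, `scaledMag · 2^b`).
* `spanSide_of_carrySpan` — the OBSERVATION that makes Lemma C redundant in Theorem S, for EVERY
  format triple and not only on the cell's 68 sum keys (where `theorems_r1.py` had found it "never
  binding"): the hypotheses of the carry branch of Theorem S — `span_C ≤ P_R`, i.e. `T ≤ P_R` and,
  if a carry out of bit `T - 1` is possible at all, `T + 1 ≤ P_R ∨ P₁ + P₂ ≤ P_R` — IMPLY the span
  inequality `Span(φ₁, φ₂, ψ)` of Lemma C′ (hypothesis (ii′) of `exactSums_of_spanSides`,
  ExactCriteria.lean). Reason: `maxScaled₂ · 2^b` is itself a `P₂`-bit significand times a power of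
  two below `2^T ≤ 2^P_R`, so it lies at least `2^(P_R - P₂) ≥ 2^P₁` below `2^P_R`, which absorbs
  the low-bit holder's `2^P₁ - 1`. Consequently `span = min(span_C, B)` of THEOREMS-R1 Theorem S
  equals `B` for every format triple, and Theorem S in full is `exactSums_of_carrySpan` below — a
  corollary of the landed sharp form, with no new case needing the carry lemma.
* A non-vacuous instance of the carry branch (no cell key is one): `e2m1 + e2m1` into the ad-hoc
  4-bit-precision format `⟨3, 0, 3, 7⟩` (quantum `1/4`, values up to `15`): `T = P_R = 4`,
  `P₁ + P₂ = 4`, and `6 + 6 ≥ 2^T` quanta-of-`1/2` carries.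
-/

namespace Summit.Ventures.CertifiedArithmetic

open Literature.ComputerArithmetic.FloatingPoint
open Literature.ComputerArithmetic.FloatingPoint.MiniFloat
open Literature.ComputerArithmetic.FloatingPoint.Format

/-! ### The arithmetic heart -/

/-- A `Q`-bit significand times a power of two that lies below `2^P`, with `Q ≤ P`, lies at least
`2^(P-Q)` below `2^P`: either `j ≥ P - Q` and `k · 2^j` is a multiple of `2^(P-Q)` below `2^P`, or
`k · 2^j < 2^(Q+j) ≤ 2^(P-1)` and `2^(P-Q) ≤ 2^(P-1)`. -/
theorem mul_pow_add_pow_le_pow {k j Q P : ℕ} (hk : k < 2 ^ Q) (hlt : k * 2 ^ j < 2 ^ P)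
    (hQ : Q ≤ P) : k * 2 ^ j + 2 ^ (P - Q) ≤ 2 ^ P := by
  obtain ⟨r, rfl⟩ := Nat.exists_eq_add_of_le hQ
  rw [Nat.add_sub_cancel_left]
  by_cases hj : r ≤ j
  · obtain ⟨s, rfl⟩ := Nat.exists_eq_add_of_le hj
    have h1 : k * 2 ^ s < 2 ^ Q := by
      have : k * 2 ^ s * 2 ^ r < 2 ^ Q * 2 ^ r := by
        calc k * 2 ^ s * 2 ^ r = k * 2 ^ (r + s) := by rw [pow_add]; ring
          _ < 2 ^ (Q + r) := hlt
          _ = 2 ^ Q * 2 ^ r := pow_add _ _ _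
      exact Nat.lt_of_mul_lt_mul_right this
    calc k * 2 ^ (r + s) + 2 ^ r = (k * 2 ^ s + 1) * 2 ^ r := by rw [pow_add]; ring
      _ ≤ 2 ^ Q * 2 ^ r := Nat.mul_le_mul_right _ h1
      _ = 2 ^ (Q + r) := (pow_add _ _ _).symm
  · rw [not_le] at hj
    rcases Nat.eq_zero_or_pos Q with hQ0 | hQ0
    · subst hQ0
      have hk0 : k = 0 := by
        have : k < 1 := by simpa using hk
        omega
      subst hk0
      simp
    · have h1 : k * 2 ^ j < 2 ^ (Q + j) := by
        rw [pow_add]; exact Nat.mul_lt_mul_of_pos_right hk (by positivity)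
      have h2 : 2 ^ (Q + j) ≤ 2 ^ (Q + r - 1) := Nat.pow_le_pow_right (by norm_num) (by omega)
      have h3 : 2 ^ r ≤ 2 ^ (Q + r - 1) := Nat.pow_le_pow_right (by norm_num) (by omega)
      have h4 : 2 ^ (Q + r - 1) + 2 ^ (Q + r - 1) = 2 ^ (Q + r) := by
        rw [← two_mul, ← pow_succ']; congr 1; omega
      omega

/-! ### Lemma C, integer core -/

/-- THEOREMS-R1 Lemma C, integer core. Let `u = k₁ · 2^j₁` (`k₁ < 2^P₁`) and `v = k₂ · 2^j₂`
(`k₂ < 2^P₂`) with `u < 2^T`; if `u + v ≥ 2^T` (the sum carries out of bit `T - 1`) then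
`2^D ∣ v` for every `D` with `D + P₁ + P₂ ≤ T + 1`. (For `j₂ < D` one would have `v < 2^(P₂ + j₂)
≤ 2^(T - P₁)` while `u ≤ 2^T - 2^(T - P₁)` by `mul_pow_add_pow_le_pow` — no carry.) The same
statement with the roles of `u`, `v` exchanged gives `2^D ∣ u`. -/
theorem pow_dvd_of_carry {P₁ P₂ T D k₁ j₁ k₂ j₂ : ℕ} (hk₁ : k₁ < 2 ^ P₁) (hk₂ : k₂ < 2 ^ P₂)
    (hu : k₁ * 2 ^ j₁ < 2 ^ T) (hc : 2 ^ T ≤ k₁ * 2 ^ j₁ + k₂ * 2 ^ j₂)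
    (hD : D + P₁ + P₂ ≤ T + 1) : 2 ^ D ∣ k₂ * 2 ^ j₂ := by
  by_cases hj : D ≤ j₂
  · exact Dvd.dvd.mul_left (pow_dvd_pow 2 hj) k₂
  exfalso
  rw [not_le] at hj
  obtain ⟨S, rfl⟩ : ∃ S, T = P₁ + S := ⟨T - P₁, by omega⟩
  have hv : k₂ * 2 ^ j₂ < 2 ^ S :=
    calc k₂ * 2 ^ j₂ < 2 ^ P₂ * 2 ^ j₂ := Nat.mul_lt_mul_of_pos_right hk₂ (by positivity)
      _ = 2 ^ (P₂ + j₂) := (pow_add _ _ _).symm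
      _ ≤ 2 ^ S := Nat.pow_le_pow_right (by norm_num) (by omega)
  have hu' := mul_pow_add_pow_le_pow hk₁ hu (Nat.le_add_right P₁ S)
  rw [Nat.add_sub_cancel_left] at hu'
  omega

/-- THEOREMS-R1 Lemma C, span form: two such magnitudes below `2^T` whose sum carries out of bit
`T - 1` have a sum `N' · 2^D` with `N' < 2^(T + 1 - D)` — with `D = T + 1 - P₁ - P₂` the sum
"spans at most `P₁ + P₂` bits". -/
theorem exists_eq_mul_pow_of_carry {P₁ P₂ T D k₁ j₁ k₂ j₂ : ℕ} (hk₁ : k₁ < 2 ^ P₁)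
    (hk₂ : k₂ < 2 ^ P₂) (hu : k₁ * 2 ^ j₁ < 2 ^ T) (hv : k₂ * 2 ^ j₂ < 2 ^ T)
    (hc : 2 ^ T ≤ k₁ * 2 ^ j₁ + k₂ * 2 ^ j₂) (hD : D + P₁ + P₂ ≤ T + 1) :
    ∃ N' : ℕ, k₁ * 2 ^ j₁ + k₂ * 2 ^ j₂ = N' * 2 ^ D ∧ N' < 2 ^ (T + 1 - D) := by
  have h₂ : 2 ^ D ∣ k₂ * 2 ^ j₂ := pow_dvd_of_carry hk₁ hk₂ hu hc hD
  have h₁ : 2 ^ D ∣ k₁ * 2 ^ j₁ :=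
    pow_dvd_of_carry hk₂ hk₁ hv (by rwa [add_comm]) (by omega)
  obtain ⟨N', hN'⟩ := dvd_add h₁ h₂
  refine ⟨N', by rw [hN', mul_comm], ?_⟩
  have hlt : N' * 2 ^ D < 2 ^ (T + 1 - D) * 2 ^ D := by
    calc N' * 2 ^ D = k₁ * 2 ^ j₁ + k₂ * 2 ^ j₂ := by rw [hN', mul_comm]
      _ < 2 ^ T + 2 ^ T := add_lt_add hu hv
      _ = 2 ^ (T + 1) := by rw [pow_succ]; ring
      _ = 2 ^ (T + 1 - D) * 2 ^ D := by rw [← pow_add]; congr 1; omega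
  exact Nat.lt_of_mul_lt_mul_right hlt

/-! ### Lemma C for data -/

/-- THEOREMS-R1 Lemma C (carry bounds the low bit) for data `x : MiniFloat φ₁`,
`y : MiniFloat φ₂`, magnitudes aligned to common quanta by arbitrary lifts `2^a`, `2^b`: if both
aligned magnitudes are below `2^T` and their sum reaches `2^T`, both are multiples of `2^D` for
every `D` with `D + P₁ + P₂ ≤ T + 1` (`P = manBits + 1`). With `T = E - L + 1` and
`D = T + 1 - P₁ - P₂` this is the lemma as printed: `|x|`, `|y|` are multiples of
`2^(E + 2 - P_X - P_Y)`. -/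
theorem pow_dvd_scaledMag_of_carry {φ₁ φ₂ : Format} (x : MiniFloat φ₁) (y : MiniFloat φ₂)
    {a b T D : ℕ} (hu : x.scaledMag * 2 ^ a < 2 ^ T) (hv : y.scaledMag * 2 ^ b < 2 ^ T)
    (hc : 2 ^ T ≤ x.scaledMag * 2 ^ a + y.scaledMag * 2 ^ b)
    (hD : D + (φ₁.manBits + 1) + (φ₂.manBits + 1) ≤ T + 1) :
    2 ^ D ∣ x.scaledMag * 2 ^ a ∧ 2 ^ D ∣ y.scaledMag * 2 ^ b := by
  obtain ⟨-, k₁, j₁, hk₁, hx⟩ := representable_iff.mp (representable_scaledMag x)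
  obtain ⟨-, k₂, j₂, hk₂, hy⟩ := representable_iff.mp (representable_scaledMag y)
  have ex : x.scaledMag * 2 ^ a = k₁ * 2 ^ (j₁ + a) := by rw [hx, pow_add, mul_assoc]
  have ey : y.scaledMag * 2 ^ b = k₂ * 2 ^ (j₂ + b) := by rw [hy, pow_add, mul_assoc]
  rw [ex] at hu hc ⊢
  rw [ey] at hv hc ⊢
  exact ⟨pow_dvd_of_carry hk₂ hk₁ hv (by rwa [add_comm]) (by omega),
    pow_dvd_of_carry hk₁ hk₂ hu hc hD⟩

/-- Span form for data: under the hypotheses of `pow_dvd_scaledMag_of_carry` the aligned exact-sum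
magnitude `|x| · 2^a + |y| · 2^b` (same signs: a genuine carry) is `N' · 2^D` with
`N' < 2^(T + 1 - D)`. -/
theorem exists_scaledMag_add_eq_of_carry {φ₁ φ₂ : Format} (x : MiniFloat φ₁) (y : MiniFloat φ₂)
    {a b T D : ℕ} (hu : x.scaledMag * 2 ^ a < 2 ^ T) (hv : y.scaledMag * 2 ^ b < 2 ^ T)
    (hc : 2 ^ T ≤ x.scaledMag * 2 ^ a + y.scaledMag * 2 ^ b)
    (hD : D + (φ₁.manBits + 1) + (φ₂.manBits + 1) ≤ T + 1) :
    ∃ N' : ℕ, x.scaledMag * 2 ^ a + y.scaledMag * 2 ^ b = N' * 2 ^ D ∧ N' < 2 ^ (T + 1 - D) := by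
  obtain ⟨-, k₁, j₁, hk₁, hx⟩ := representable_iff.mp (representable_scaledMag x)
  obtain ⟨-, k₂, j₂, hk₂, hy⟩ := representable_iff.mp (representable_scaledMag y)
  have ex : x.scaledMag * 2 ^ a = k₁ * 2 ^ (j₁ + a) := by rw [hx, pow_add, mul_assoc]
  have ey : y.scaledMag * 2 ^ b = k₂ * 2 ^ (j₂ + b) := by rw [hy, pow_add, mul_assoc]
  rw [ex] at hu hc ⊢
  rw [ey] at hv hc ⊢
  exact exists_eq_mul_pow_of_carry hk₁ hk₂ hu hv hc hD

/-! ### The carry branch of Theorem S is subsumed by Lemma C′ -/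

/-- For EVERY format triple: the hypotheses of the carry branch of THEOREMS-R1 Theorem S — a strict
bit bound `T` of both aligned operand maxima with `T ≤ P_R`, and (`span_C ≤ P_R`) either no carry
out of bit `T - 1` is possible (`maxScaled₁ 2^a + maxScaled₂ 2^b < 2^T`) or `T + 1 ≤ P_R` or
`P₁ + P₂ ≤ P_R` — imply the span inequality `Span(φ₁, φ₂, ψ)` of Lemma C′ (hypothesis (ii′) of
`exactSums_of_spanSides`). One lift is `0` (common quantum = the finer operand quantum). Key step
(`P₁ + P₂ ≤ P_R`, `a = 0`): `maxScaled₂ · 2^b` is a `P₂`-bit significand times a power of two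
below `2^P_R`, hence `≤ 2^P_R - 2^(P_R - P₂) ≤ 2^P_R - 2^P₁` (`mul_pow_add_pow_le_pow`). -/
theorem spanSide_of_carrySpan {φ₁ φ₂ ψ : Format} {a b T : ℕ}
    (hu : φ₁.maxScaled * 2 ^ a < 2 ^ T) (hv : φ₂.maxScaled * 2 ^ b < 2 ^ T) (hab : a = 0 ∨ b = 0)
    (hT : T ≤ ψ.manBits + 1)
    (hC : φ₁.maxScaled * 2 ^ a + φ₂.maxScaled * 2 ^ b < 2 ^ T ∨ T + 1 ≤ ψ.manBits + 1 ∨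
      φ₁.manBits + 1 + (φ₂.manBits + 1) ≤ ψ.manBits + 1) :
    min φ₁.maxScaled (2 ^ (φ₁.manBits + 1) - 1) * 2 ^ a + φ₂.maxScaled * 2 ^ b
      < 2 ^ (ψ.manBits + 1 + a) := by
  have hmin₁ : min φ₁.maxScaled (2 ^ (φ₁.manBits + 1) - 1) ≤ φ₁.maxScaled := min_le_left _ _
  have hmin₂ : min φ₁.maxScaled (2 ^ (φ₁.manBits + 1) - 1) ≤ 2 ^ (φ₁.manBits + 1) - 1 :=
    min_le_right _ _
  have hPT : 2 ^ T ≤ 2 ^ (ψ.manBits + 1) := Nat.pow_le_pow_right (by norm_num) hT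
  have hPa : 2 ^ (ψ.manBits + 1) ≤ 2 ^ (ψ.manBits + 1 + a) :=
    Nat.pow_le_pow_right (by norm_num) (Nat.le_add_right _ _)
  have hle : min φ₁.maxScaled (2 ^ (φ₁.manBits + 1) - 1) * 2 ^ a ≤ φ₁.maxScaled * 2 ^ a :=
    Nat.mul_le_mul_right _ hmin₁
  rcases hC with hC | hC | hC
  · -- no carry possible: everything stays below `2^T ≤ 2^P_R`
    omega
  · -- `T + 1 ≤ P_R`: the sum is below `2^(T+1) ≤ 2^P_R`
    have h2 : 2 ^ (T + 1) ≤ 2 ^ (ψ.manBits + 1) := Nat.pow_le_pow_right (by norm_num) hC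
    rw [pow_succ] at h2
    omega
  · -- `P₁ + P₂ ≤ P_R`
    have hP₁ : 2 ^ (φ₁.manBits + 1) ≤ 2 ^ (ψ.manBits + 1 - (φ₂.manBits + 1)) :=
      Nat.pow_le_pow_right (by norm_num) (by omega)
    rcases Nat.eq_zero_or_pos a with ha | ha
    · subst ha
      -- `maxScaled₂ · 2^b = k · 2^(j+b)` with `k < 2^P₂`, below `2^P_R`
      obtain ⟨-, k, j, hk, hkj⟩ := representable_iff.mp (representable_maxScaled φ₂)
      have ev : φ₂.maxScaled * 2 ^ b = k * 2 ^ (j + b) := by rw [hkj, pow_add, mul_assoc]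
      have hvP : k * 2 ^ (j + b) < 2 ^ (ψ.manBits + 1) := by rw [← ev]; omega
      have key := mul_pow_add_pow_le_pow hk hvP (by omega)
      rw [← ev] at key
      have h1 : 1 ≤ 2 ^ (φ₁.manBits + 1) := Nat.one_le_two_pow
      rw [pow_zero, mul_one, add_zero]
      omega
    · -- `b = 0`, `a ≥ 1`: `(2^P₁ - 1) 2^a < 2^(P_R + a - 1)` and `maxScaled₂ < 2^P_R ≤ 2^(P_R+a-1)`
      have hb : b = 0 := by omega
      subst hb
      rw [pow_zero, mul_one] at hv ⊢
      have h1 : (2 ^ (φ₁.manBits + 1) - 1) * 2 ^ a < 2 ^ (ψ.manBits + 1 + a - 1) := by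
        have hlt : 2 ^ (φ₁.manBits + 1) - 1 < 2 ^ (φ₁.manBits + 1) :=
          Nat.sub_lt (Nat.two_pow_pos _) Nat.one_pos
        calc (2 ^ (φ₁.manBits + 1) - 1) * 2 ^ a < 2 ^ (φ₁.manBits + 1) * 2 ^ a :=
              Nat.mul_lt_mul_of_pos_right hlt (by positivity)
          _ = 2 ^ (φ₁.manBits + 1 + a) := (pow_add _ _ _).symm
          _ ≤ 2 ^ (ψ.manBits + 1 + a - 1) := Nat.pow_le_pow_right (by norm_num) (by omega)
      have h2 : 2 ^ (ψ.manBits + 1) ≤ 2 ^ (ψ.manBits + 1 + a - 1) :=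
        Nat.pow_le_pow_right (by norm_num) (by omega)
      have h3 : 2 ^ (ψ.manBits + 1 + a - 1) + 2 ^ (ψ.manBits + 1 + a - 1)
          = 2 ^ (ψ.manBits + 1 + a) := by
        rw [← two_mul, ← pow_succ']; congr 1; omega
      have h4 : min φ₁.maxScaled (2 ^ (φ₁.manBits + 1) - 1) * 2 ^ a
          ≤ (2 ^ (φ₁.manBits + 1) - 1) * 2 ^ a := Nat.mul_le_mul_right _ hmin₂
      omega

/-- THEOREMS-R1 Theorem S with hypothesis (ii) in its CARRY form `span_C ≤ P_R` (Lemma C): (i)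
`qexp_R ≤ min(qexp₁, qexp₂)`; a strict bit bound `T` of both aligned maxima (`T = E - L + 1` in
the notation of THEOREMS-R1) with `T ≤ P_R` and — if a carry out of the top bit is possible at
all — `T + 1 ≤ P_R` or `P₁ + P₂ ≤ P_R`; (iii) `maxRat₁ + maxRat₂ ≤ maxRat_R`. By
`spanSide_of_carrySpan` (both sides) this is a COROLLARY of the sharp form
`exactSums_of_spanSides`: the carry branch never decides a key that Lemma C′ does not. -/
theorem exactSums_of_carrySpan (φ₁ φ₂ ψ : Format) (hL : ψ.qexp ≤ min φ₁.qexp φ₂.qexp) {T : ℕ}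
    (hu : φ₁.maxScaled * 2 ^ (φ₁.qexp - φ₂.qexp).toNat < 2 ^ T)
    (hv : φ₂.maxScaled * 2 ^ (φ₂.qexp - φ₁.qexp).toNat < 2 ^ T) (hT : T ≤ ψ.manBits + 1)
    (hC : φ₁.maxScaled * 2 ^ (φ₁.qexp - φ₂.qexp).toNat
        + φ₂.maxScaled * 2 ^ (φ₂.qexp - φ₁.qexp).toNat < 2 ^ T ∨
      T + 1 ≤ ψ.manBits + 1 ∨ φ₁.manBits + 1 + (φ₂.manBits + 1) ≤ ψ.manBits + 1)
    (hM : φ₁.maxRat + φ₂.maxRat ≤ ψ.maxRat) : ExactSums φ₁ φ₂ ψ := by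
  have hab : (φ₁.qexp - φ₂.qexp).toNat = 0 ∨ (φ₂.qexp - φ₁.qexp).toNat = 0 := by omega
  refine exactSums_of_spanSides φ₁ φ₂ ψ hL (spanSide_of_carrySpan hu hv hab hT hC)
    (spanSide_of_carrySpan hv hu hab.symm hT ?_) hM
  rcases hC with h | h | h
  · exact Or.inl (by rwa [add_comm])
  · exact Or.inr (Or.inl h)
  · exact Or.inr (Or.inr (by omega))

/-- A NON-VACUOUS instance of the carry branch (none of the cell's 68 sum keys is one): `e2m1 +
e2m1` (`P = 2`, quantum `1/2`, magnitudes `≤ 12 < 2^4` quanta) into the ad-hoc format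
`⟨3, 0, 3, 7⟩` (`P_R = 4`, quantum `1/4`, largest value `15`): `T = P_R = 4 = P₁ + P₂` and
`12 + 12 ≥ 2^4` — a carry is possible, the coarse `S₀` fails, and the sum is exact. -/
example : ExactSums E2M1 E2M1 ⟨3, 0, 3, 7, by decide⟩ :=
  exactSums_of_carrySpan E2M1 E2M1 _ (by decide) (T := 4) (by decide) (by decide) (by decide)
    (Or.inr (Or.inr (by decide))) (by decide +kernel)

end Summit.Ventures.CertifiedArithmetic
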